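import Summits.SmoothPoincare4.SmoothPoincare4.Theorems.SymplecticOrigamiOrigamiFoldExistenceStubCleanOnePleatIroningSigns
import Summits.SmoothPoincare4.SmoothPoincare4.Theorems.SymplecticOrigamiOrigamiFoldExistenceStubCleanOnePleatIroningCrease
import Summits.SmoothPoincare4.SmoothPoincare4.Theorems.SymplecticOrigamiOrigamiFoldExistenceStubCleanOnePleatIroningSide
import Summits.SmoothPoincare4.SmoothPoincare4.Theorems.SymplecticOrigamiOrigamiFoldExistenceStubCleanOnePleatIroningInverse
import Summits.SmoothPoincare4.SmoothPoincare4.Theorems.SymplecticOrigamiOrigamiFoldExistenceStubCleanOnePleatIroningStraighten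
import Summits.SmoothPoincare4.SmoothPoincare4.Theorems.SymplecticOrigamiOrigamiFoldExistenceStubCleanOnePleatIroningSheets
import Summits.SmoothPoincare4.SmoothPoincare4.Theorems.SymplecticOrigamiOrigamiFoldExistenceStubCleanOnePleatIroningDeletion

/-!
# Stub `stub_cleanOnePleatIroning` of line `shadow-pleats` for crux `OrigamiFoldExistence`:
# CLEAN ONE-PLEAT IRONING (item stmt-SmoothPoincare4-7844, route SymplecticOrigami; seat c3, S5a worker, wave 2)

Final file of the registered stub `stub_cleanOnePleatIroning` (S5a): **a homotopy `4`-sphere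
with a CLEAN `1`-pleat round-rim shadow position has a pleat-free one**
(`HasCleanPleatedPosition M 1 → HasPleatedPosition M 0`).  File III (`…Deletion`) reduced the
stub, kernel-checked, to ONE named ingredient `CleanPleatIroningChart` (ironing charts exist for
clean single pleats); here it is PROVED and the stub follows.  With `G = proj5 ∘ ι ∘ e 0` the
chart shadow, `ε` the cleanness width, `R = 2 + ε/2`, `η₀ = ε/4`, `r₀ = 1/2`:

* ORIENTATION (this file, over file VIII): the Jacobian `det dG` changes sign across each of
  the two fold spheres (`exists_det_mul_neg_across`: a simple zero along `t ↦ r e₀ + t v`,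
  `v` the fold kernel), and is of constant sign on the hole, the open annulus and the open
  collar, hence `det dG(e₀/2) · det dG(R e₀) > 0` (`det_fderiv_hole_mul_collar_pos`,
  registered sub-goal);
* SMOOTH HALF (`exists_cleanPleatBallFilling`, registered sub-goal): the standard-ball
  filling `Λ₀ = θ ∘ G ∘ ((r₀/R) ·)` of the crease (file XIII: radial isotopy, file VI, and
  orientation-preserving isotopy extension, file VII) satisfies `det dΛ₀ · det dG > 0` at
  `R e₀`, so the inner chart collar enters `Λ₀(B_R)` (file X), is an inner collar of the
  filled ball (file XI), and is straightened by uniqueness of collars (file XII): a smooth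
  `Λ`, injective and immersive on `B̄_R`, equal to `G` off `B_{R-η}`;
* TOPOLOGICAL HALF (file XIV): the shadow `σ` of the patched map
  `patch ι (e 0) R (ironF Λ ι (e 0))` is a MODIFIED SHADOW (smooth, immersive above the plane
  — no fold is left —, the old shadow near the seam), so its fibres over the open ball of
  radius `ρ` from `{h > 1 - δ}` are singletons; a foreign point casting its shadow into
  `Λ(B_R)` and the chart point under it would be two — the NO-FOREIGN-SHADOW clause;
* `cleanPleatIroningChart : CleanPleatIroningChart`, and `stub_cleanOnePleatIroning` is
  `cleanOnePleatIroning_of_ironingChart` (file III) applied to it.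

Sources: Disproof.lean §7c (γ)/(γ′); W-Morse-analysis-c2.md §4.3; M. Golubitsky,
V. Guillemin, *Stable mappings and their singularities* (1973), Ch. III §4; M. W. Hirsch,
*Differential Topology* (1976), Ch. 4 §6, Ch. 8 §1; files I–XIV of this stub.
-/

noncomputable section

-- the prescribed namespace `Summit.<P>.<Sub>.…` duplicates `SmoothPoincare4` (P = Sub)
set_option linter.dupNamespace false

open scoped Manifold ContDiff Topology RealInnerProductSpace
open Set Function Filter Metric Module ContinuousMap

namespace Summit.SmoothPoincare4.SmoothPoincare4.Theorems.OrigamiFoldExistence.ShadowPleats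

/-! ### Orientation: `det dG` has the same sign on the hole and on the collar -/

section Orientation

variable {M : Type} [TopologicalSpace M] [ChartedSpace (EuclideanSpace ℝ (Fin 4)) M]
  {ι : M → EuclideanSpace ℝ (Fin 5)} {δ : ℝ} {e : Fin 1 → EuclideanSpace ℝ (Fin 4) → M}

/-- Squared norms decide strict norm inequalities. -/
theorem norm_lt_iff_sq_lt {u : EuclideanSpace ℝ (Fin 4)} {c : ℝ} (hc : 0 ≤ c) :
    ‖u‖ < c ↔ ‖u‖ ^ 2 < c ^ 2 := by
  rw [sq_lt_sq, abs_of_nonneg (norm_nonneg _), abs_of_nonneg hc]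

/-- Squared norms decide strict norm inequalities. -/
theorem lt_norm_iff_sq_lt {u : EuclideanSpace ℝ (Fin 4)} {c : ℝ} (hc : 0 ≤ c) :
    c < ‖u‖ ↔ c ^ 2 < ‖u‖ ^ 2 := by
  rw [sq_lt_sq, abs_of_nonneg (norm_nonneg _), abs_of_nonneg hc]

/-- The squared norm of `r e₀ + t v`. -/
theorem norm_sq_axis_add_smul (r t : ℝ) (v : EuclideanSpace ℝ (Fin 4)) :
    ‖r • EuclideanSpace.single (0 : Fin 4) (1 : ℝ) + t • v‖ ^ 2 =
      r ^ 2 + 2 * (t * (r * v 0)) + t ^ 2 * ‖v‖ ^ 2 := by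
  rw [norm_add_sq_real, norm_smul, norm_smul, real_inner_smul_left, real_inner_smul_right,
    EuclideanSpace.inner_single_left]
  simp [mul_pow, sq_abs]
  ring

/-- **Fold data on the `e₀`-axis**: for a `1`-pleat position and `r ∈ {1, 2}`, at the fold
point `r e₀` there is a kernel vector `v` of the chart-shadow differential with `v 0 ≠ 0`
(kernel transversality, file VI) satisfying the fold condition. -/
theorem exists_foldData_axis (h : IsPleatedPosition ι δ e) {r : ℝ} (hr : r = 1 ∨ r = 2) :
    ∃ v : EuclideanSpace ℝ (Fin 4), v 0 ≠ 0 ∧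
      fderiv ℝ (proj5 ∘ ι ∘ e 0) (r • EuclideanSpace.single (0 : Fin 4) (1 : ℝ)) v = 0 ∧
      fderiv ℝ (fun w => fderiv ℝ (proj5 ∘ ι ∘ e 0) w v)
          (r • EuclideanSpace.single (0 : Fin 4) (1 : ℝ)) v ∉
        LinearMap.range (fderiv ℝ (proj5 ∘ ι ∘ e 0)
          (r • EuclideanSpace.single (0 : Fin 4) (1 : ℝ))).toLinearMap := by
  set u₀ : EuclideanSpace ℝ (Fin 4) := r • EuclideanSpace.single (0 : Fin 4) (1 : ℝ) with hu₀
  have hr0 : 0 < r := by rcases hr with rfl | rfl <;> norm_num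
  have hmem : u₀ ∈ pleatSpheres := by
    have hn : ‖u₀‖ = r := by
      rw [hu₀, norm_smul, PiLp.norm_single, norm_one, mul_one, Real.norm_of_nonneg hr0.le]
    rcases hr with rfl | rfl
    · exact Or.inl (mem_sphere_zero_iff_norm.2 hn)
    · exact Or.inr (mem_sphere_zero_iff_norm.2 hn)
  obtain ⟨v, hv, hker, hfold⟩ := h.2.2.2.2.2.2.2 0 u₀ hmem
  refine ⟨v, fun hv0 => hv ?_, hker, hfold⟩
  have horth : ⟪u₀, v⟫ = 0 := by
    rw [hu₀, real_inner_smul_left, EuclideanSpace.inner_single_left, hv0]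
    simp
  exact chartShadow_kernel h u₀ v horth hker

/-- **The Jacobian of the chart shadow changes sign across each fold sphere** (file VIII along
`t ↦ r e₀ + t v`): for `r ∈ {1, 2}` and `0 ≤ a < r < b` there are points `p`, `q` with
`a < |p| < r < |q| < b` and `det dG(p) · det dG(q) < 0`. [folklore] -/
theorem exists_det_mul_neg_across (h : IsPleatedPosition ι δ e) {r a b : ℝ} (hr : r = 1 ∨ r = 2)
    (ha0 : 0 ≤ a) (har : a < r) (hrb : r < b) :
    ∃ p q : EuclideanSpace ℝ (Fin 4), a < ‖p‖ ∧ ‖p‖ < r ∧ r < ‖q‖ ∧ ‖q‖ < b ∧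
      (fderiv ℝ (proj5 ∘ ι ∘ e 0) p).det * (fderiv ℝ (proj5 ∘ ι ∘ e 0) q).det < 0 := by
  have hr0 : 0 < r := by rcases hr with rfl | rfl <;> norm_num
  obtain ⟨v, hv0, hker, hfold⟩ := exists_foldData_axis h hr
  have hu₀ : ∀ j : Fin 4, j ≠ 0 → (r • EuclideanSpace.single (0 : Fin 4) (1 : ℝ)) j = 0 := by
    intro j hj; simp [hj]
  set s : ℝ := r * v 0 with hs
  have hs0 : s ≠ 0 := mul_ne_zero hr0.ne' hv0
  have hsabs : 0 < |s| := abs_pos.2 hs0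
  have hvne : ‖v‖ ≠ 0 := by
    intro h0; rw [norm_eq_zero] at h0; exact hv0 (by rw [h0]; rfl)
  have hvn : 0 < ‖v‖ ^ 2 := by positivity
  set gap : ℝ := min (b ^ 2 - r ^ 2) (r ^ 2 - a ^ 2) with hgap
  have hgap0 : 0 < gap := lt_min (by nlinarith) (by nlinarith)
  have hgb : gap ≤ b ^ 2 - r ^ 2 := min_le_left _ _
  have hga : gap ≤ r ^ 2 - a ^ 2 := min_le_right _ _
  set τ : ℝ := min (|s| / ‖v‖ ^ 2) (gap / (3 * |s|)) with hτ
  obtain ⟨t, ht0, htτ, hneg⟩ := exists_det_fderiv_mul_neg_fold (contDiff_chartShadow h) hu₀ hv0 hker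
    hfold (fun w hw hGw => chartShadow_kernel h _ w hw hGw) (lt_min (by positivity) (by positivity) : 0 < τ)
  have ht1 : t ^ 2 * ‖v‖ ^ 2 < t * |s| := by
    have h' : t * ‖v‖ ^ 2 < |s| := by
      calc t * ‖v‖ ^ 2 < |s| / ‖v‖ ^ 2 * ‖v‖ ^ 2 := by gcongr; exact htτ.trans_le (min_le_left _ _)
        _ = |s| := by field_simp
    nlinarith
  have ht2 : 3 * (t * |s|) < gap := by
    calc 3 * (t * |s|) < 3 * (gap / (3 * |s|) * |s|) := by gcongr; exact htτ.trans_le (min_le_right _ _)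
      _ = gap := by field_simp
  have hplus : ‖r • EuclideanSpace.single (0 : Fin 4) (1 : ℝ) + t • v‖ ^ 2 =
      r ^ 2 + 2 * (t * s) + t ^ 2 * ‖v‖ ^ 2 := by rw [norm_sq_axis_add_smul]
  have hminus : ‖r • EuclideanSpace.single (0 : Fin 4) (1 : ℝ) + (-t) • v‖ ^ 2 =
      r ^ 2 - 2 * (t * s) + t ^ 2 * ‖v‖ ^ 2 := by rw [norm_sq_axis_add_smul]; ring
  rcases hs0.lt_or_gt with hsneg | hspos
  · have hsa : |s| = -s := abs_of_neg hsneg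
    refine ⟨_, _, ?_, ?_, ?_, ?_, hneg⟩
    · rw [lt_norm_iff_sq_lt ha0, hplus]; nlinarith
    · rw [norm_lt_iff_sq_lt hr0.le, hplus]; nlinarith
    · rw [lt_norm_iff_sq_lt hr0.le, hminus]; nlinarith
    · rw [norm_lt_iff_sq_lt (hr0.le.trans hrb.le), hminus]; nlinarith
  · have hsa : |s| = s := abs_of_pos hspos
    refine ⟨_, _, ?_, ?_, ?_, ?_, by rw [mul_comm]; exact hneg⟩
    · rw [lt_norm_iff_sq_lt ha0, hminus]; nlinarith
    · rw [norm_lt_iff_sq_lt hr0.le, hminus]; nlinarith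
    · rw [lt_norm_iff_sq_lt hr0.le, hplus]; nlinarith
    · rw [norm_lt_iff_sq_lt (hr0.le.trans hrb.le), hplus]; nlinarith

/-- **The Jacobian of the chart shadow of a single pleat has the SAME SIGN on the open hole
`B_1` and on the open collar `{2 < |u| < 2 + ε}`**: it changes sign across each of the two fold
spheres and is of constant sign on the hole, the open annulus and the open collar (preconnected
sets on which the chart shadow is immersive, file VIII). [folklore] -/
theorem det_fderiv_hole_mul_collar_pos (h : IsPleatedPosition ι δ e) {ε : ℝ} (hε : 0 < ε)
    {a c : EuclideanSpace ℝ (Fin 4)} (ha : ‖a‖ < 1) (hc2 : 2 < ‖c‖) (hcε : ‖c‖ < 2 + ε) :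
    0 < (fderiv ℝ (proj5 ∘ ι ∘ e 0) a).det * (fderiv ℝ (proj5 ∘ ι ∘ e 0) c).det := by
  have hG := contDiff_chartShadow h
  have himm : ∀ u : EuclideanSpace ℝ (Fin 4), ‖u‖ ≠ 1 → ‖u‖ ≠ 2 →
      Injective (fderiv ℝ (proj5 ∘ ι ∘ e 0) u) := by
    intro u h1 h2
    refine injective_fderiv_chartShadow h ?_
    rintro (hu | hu)
    · exact h1 (mem_sphere_zero_iff_norm.1 hu)
    · exact h2 (mem_sphere_zero_iff_norm.1 hu)
  obtain ⟨a₁, b₁, -, ha₁, hb₁, hb₁', hneg₁⟩ :=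
    exists_det_mul_neg_across h (Or.inl rfl) (a := 0) (b := 2) le_rfl one_pos one_lt_two
  obtain ⟨b₂, c₂, hb₂, hb₂', hc₂, hc₂', hneg₂⟩ :=
    exists_det_mul_neg_across h (Or.inr rfl) (a := 1) (b := 2 + ε) zero_le_one one_lt_two
      (lt_add_of_pos_right 2 hε)
  have hH : 0 < (fderiv ℝ (proj5 ∘ ι ∘ e 0) a).det * (fderiv ℝ (proj5 ∘ ι ∘ e 0) a₁).det :=
    det_fderiv_mul_pos_of_isPreconnected hG (convex_ball (0 : EuclideanSpace ℝ (Fin 4)) 1).isPreconnected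
      (fun u hu => himm u (by rw [mem_ball_zero_iff] at hu; exact hu.ne)
        (by rw [mem_ball_zero_iff] at hu; linarith))
      (mem_ball_zero_iff.2 ha) (mem_ball_zero_iff.2 ha₁)
  have hA : 0 < (fderiv ℝ (proj5 ∘ ι ∘ e 0) b₁).det * (fderiv ℝ (proj5 ∘ ι ∘ e 0) b₂).det :=
    det_fderiv_mul_pos_of_isPreconnected hG (isPreconnected_openShell one_pos (b := 2))
      (fun u hu => himm u hu.1.ne' hu.2.ne) ⟨hb₁, hb₁'⟩ ⟨hb₂, hb₂'⟩
  have hC : 0 < (fderiv ℝ (proj5 ∘ ι ∘ e 0) c₂).det * (fderiv ℝ (proj5 ∘ ι ∘ e 0) c).det :=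
    det_fderiv_mul_pos_of_isPreconnected hG (isPreconnected_openShell two_pos (b := 2 + ε))
      (fun u hu => himm u (by linarith [hu.1]) hu.1.ne') ⟨hc₂, hc₂'⟩ ⟨hc2, hcε⟩
  set A := (fderiv ℝ (proj5 ∘ ι ∘ e 0) a).det
  set A₁ := (fderiv ℝ (proj5 ∘ ι ∘ e 0) a₁).det
  set B₁ := (fderiv ℝ (proj5 ∘ ι ∘ e 0) b₁).det
  set B₂ := (fderiv ℝ (proj5 ∘ ι ∘ e 0) b₂).det
  set C₂ := (fderiv ℝ (proj5 ∘ ι ∘ e 0) c₂).det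
  set C := (fderiv ℝ (proj5 ∘ ι ∘ e 0) c).det
  have h1 : 0 < (A * A₁) * (B₁ * B₂) * (C₂ * C) := by positivity
  have h2 : 0 < (A₁ * B₁) * (B₂ * C₂) := mul_pos_of_neg_of_neg hneg₁ hneg₂
  have h3 : (A * A₁) * (B₁ * B₂) * (C₂ * C) = (A * C) * ((A₁ * B₁) * (B₂ * C₂)) := by ring
  rw [h3] at h1
  exact (mul_pos_iff_of_pos_right h2).1 h1

end Orientation

/-! ### The smooth half: a filling of the crease continuing the chart shadow -/

section Straighten

variable {G Λ₀ : EuclideanSpace ℝ (Fin 4) → EuclideanSpace ℝ (Fin 4)}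

/-- **A filling of the crease that continues the chart shadow (step (S3), files XI–XII
combined).**  In the setting of file X — `Λ₀ = G` on `S_R`, `Λ₀` an injective immersion of
`B_{R'}`, `G` an injective immersion of the shell `{R - η₀ < |u| < R + η₀}`, inner shell mapped
by `G` into `Λ₀(B_R)` — there are `η ∈ (0, η₀]` and a smooth `Λ`, injective and immersive on
`B̄_R`, equal to `G` at every point of norm `≥ R - η`. [folklore] -/
theorem exists_filling_of_innerShell (hG : ContDiff ℝ ∞ G) (hΛ : ContDiff ℝ ∞ Λ₀) {R R' η₀ : ℝ}
    (hR : 0 < R) (hRR' : R < R') (hη₀ : 0 < η₀) (hη₀R : η₀ < R)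
    (hΛimm : ∀ u ∈ ball (0 : EuclideanSpace ℝ (Fin 4)) R', Injective (fderiv ℝ Λ₀ u))
    (hΛinj : InjOn Λ₀ (ball (0 : EuclideanSpace ℝ (Fin 4)) R'))
    (hagree : ∀ u : EuclideanSpace ℝ (Fin 4), ‖u‖ = R → Λ₀ u = G u)
    (hGinj : InjOn G {u : EuclideanSpace ℝ (Fin 4) | R - η₀ < ‖u‖ ∧ ‖u‖ < R + η₀})
    (hGimm : ∀ u : EuclideanSpace ℝ (Fin 4), R - η₀ < ‖u‖ → ‖u‖ < R + η₀ →
      Injective (fderiv ℝ G u))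
    (hT1 : G '' {u : EuclideanSpace ℝ (Fin 4) | R - η₀ < ‖u‖ ∧ ‖u‖ < R} ⊆ Λ₀ '' ball 0 R) :
    ∃ (η : ℝ) (Λ : EuclideanSpace ℝ (Fin 4) → EuclideanSpace ℝ (Fin 4)), 0 < η ∧ η ≤ η₀ ∧
      ContDiff ℝ ∞ Λ ∧ InjOn Λ (closedBall 0 R) ∧
      (∀ u ∈ closedBall (0 : EuclideanSpace ℝ (Fin 4)) R, Injective (fderiv ℝ Λ u)) ∧
      (∀ u : EuclideanSpace ℝ (Fin 4), R - η ≤ ‖u‖ → Λ u = G u) := by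
  obtain ⟨ε', θc, θinv, -, hε'η, hcol, hkey⟩ :=
    exists_isInnerCollar hG hΛ hR hRR' hη₀ hη₀R hΛimm hΛinj hagree hGinj hGimm hT1
  exact exists_filling_of_innerCollar hG hΛ hR hRR' hη₀ hΛimm hΛinj hagree hGinj hGimm hε'η hcol hkey

end Straighten

section Filling

variable {M : Type} [TopologicalSpace M] [ChartedSpace (EuclideanSpace ℝ (Fin 4)) M]
  {ι : M → EuclideanSpace ℝ (Fin 5)} {δ : ℝ} {e : Fin 1 → EuclideanSpace ℝ (Fin 4) → M}

/-- **The smooth half of `CleanPleatIroningChart`.**  For a single-pleat round-rim position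
whose chart `e 0` is clean there are `R > 2`, `η ∈ (0, R - 2)` and a smooth `Λ : ℝ⁴ → ℝ⁴`,
injective with injective differential on the closed ball `B̄_R`, which equals the chart shadow
`proj5 ∘ ι ∘ e 0` at every point of norm `≥ R - η` (file XIII's filling data, the orientation
count, side determination (file X), inner collar (file XI) and straightening (file XII)).
[folklore] -/
theorem exists_cleanPleatBallFilling (h : IsPleatedPosition ι δ e) (hc : IsCleanPleat ι (e 0)) :
    ∃ (R η : ℝ) (Λ : EuclideanSpace ℝ (Fin 4) → EuclideanSpace ℝ (Fin 4)), 2 < R ∧ 0 < η ∧ η < R - 2 ∧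
      ContDiff ℝ ∞ Λ ∧ InjOn Λ (closedBall 0 R) ∧
      (∀ u ∈ closedBall (0 : EuclideanSpace ℝ (Fin 4)) R, Injective (fderiv ℝ Λ u)) ∧
      (∀ u : EuclideanSpace ℝ (Fin 4), R - η ≤ ‖u‖ → Λ u = proj5 (ι (e 0 u))) := by
  obtain ⟨ε, Λ₀, hε, hΛs, hΛimm, hΛinj, hagree, hGinjC, hGimmC, hsign⟩ := exists_creaseFillingData h hc
  have hGs : ContDiff ℝ ∞ (proj5 ∘ ι ∘ e 0) := contDiff_chartShadow h
  set R : ℝ := 2 + ε / 2 with hR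
  have hRpos : 0 < R := by positivity
  have hRR' : R < 2 * R := by linarith
  have hη₀pos : 0 < ε / 4 := by positivity
  have hη₀R : ε / 4 < R := by rw [hR]; linarith
  -- the orientation input at `R e₀`
  have he0 : ‖EuclideanSpace.single (0 : Fin 4) (1 : ℝ)‖ = 1 := by rw [PiLp.norm_single, norm_one]
  have hsign' := hsign (det_fderiv_hole_mul_collar_pos h hε
    (by rw [norm_smul, he0, mul_one, Real.norm_of_nonneg (by norm_num : (0 : ℝ) ≤ 1 / 2)]; norm_num)
    (by rw [norm_smul, he0, mul_one, Real.norm_of_nonneg hRpos.le, hR]; linarith)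
    (by rw [norm_smul, he0, mul_one, Real.norm_of_nonneg hRpos.le, hR]; linarith))
  -- (T1) the inner chart collar enters the filled region
  have hGinj' : InjOn (proj5 ∘ ι ∘ e 0) {u : EuclideanSpace ℝ (Fin 4) | R - ε / 4 < ‖u‖ ∧ ‖u‖ ≤ R} :=
    hGinjC.mono fun u (hu : R - ε / 4 < ‖u‖ ∧ ‖u‖ ≤ R) =>
      show R - ε / 4 < ‖u‖ ∧ ‖u‖ < R + ε / 4 from ⟨hu.1, by linarith [hu.2]⟩
  have hT1 := image_innerShell_subset hGs hΛs hRpos hRR' hη₀pos hη₀R hΛimm hagree hGinj' hsign'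
  -- (S3) the collar is an inner collar of the filled ball; straighten it
  obtain ⟨ε', θc, θinv, -, hε'η, hcol, hkey⟩ :=
    exists_isInnerCollar hGs hΛs hRpos hRR' hη₀pos hη₀R hΛimm hΛinj hagree hGinjC hGimmC hT1
  obtain ⟨η, Λ, hη, hηle, hΛsm, hΛinjOn, hΛimm', hΛagree⟩ := exists_filling_of_innerCollar hGs hΛs
    hRpos hRR' hη₀pos hΛimm hΛinj hagree hGinjC hGimmC hε'η hcol hkey
  refine ⟨R, η, Λ, by rw [hR]; linarith, hη, ?_, hΛsm, hΛinjOn, hΛimm', fun u hu => hΛagree u hu⟩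
  rw [hR]; linarith

end Filling

/-! ### The ironing chart and the stub -/

/-- **IRONING CHARTS EXIST for clean single pleats** (`CleanPleatIroningChart`, the named
ingredient of file III, now a theorem): for every `1`-pleat round-rim position of a homotopy
`4`-sphere whose chart is clean there are `R ≥ 2`, `η > 0` and a smooth `Λ : ℝ⁴ → ℝ⁴`,
injective and immersive on `B̄_R`, continuing the chart shadow across the seam shell
`R ≤ |u| ≤ R + η`, over whose image `Λ(B_R)` no point of `M` above the plane and outside the
chart ball casts its shadow. [folklore] -/
theorem cleanPleatIroningChart : CleanPleatIroningChart := by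
  intro M _ _ _ _ _ hM ι δ e hpos hclean
  haveI : CompactSpace M :=
    Literature.Topology.FourManifolds.compactSpace_of_homotopyEquiv_sphere_four_holds M hM
  obtain ⟨R, η, Λ, hR2, hη, -, hΛ, hinj, hd, hagree⟩ := exists_cleanPleatBallFilling hpos hclean
  refine ⟨R, η, Λ, hR2.le, hη, hΛ, hinj, hd, fun u hu _ => hagree u (by linarith), ?_⟩
  -- the NO-FOREIGN-SHADOW clause
  rintro m hm hnot ⟨u, hu, hux⟩
  obtain ⟨hι, hδ, hδ1, hround, hcharts, -, hclause, -⟩ := hpos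
  have he : Manifold.IsSmoothEmbedding (𝓡 4) (𝓡 4) ∞ (e 0) := (hcharts 0).1
  have hold : ∀ v, 1 - δ < ι (e 0 v) 4 := (hcharts 0).2
  have hu' : ‖u‖ < R := mem_ball_zero_iff.1 hu
  -- the patched map over the ironing chart and its shadow `σ`
  set F := ironF Λ ι (e 0) with hF
  have hFsmooth : ContDiff ℝ ∞ F := contDiff_ironF hΛ (hι.contMDiff.comp he.contMDiff)
  have hFagree : ∀ v, R ≤ ‖v‖ → ‖v‖ ≤ R + 1 → F v = ι (e 0 v) := fun v h1 _ =>
    ironF_eq_of_eq (hagree v (by linarith))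
  set σ : M → EuclideanSpace ℝ (Fin 4) := proj5 ∘ patch ι (e 0) R F with hσdef
  have hσ : ContMDiff (𝓡 4) (𝓡 4) ∞ σ := by
    rw [hσdef, ← coe_proj5L]
    exact proj5L.contDiff.contMDiff.comp (contMDiff_patch hι.contMDiff he hFsmooth one_pos hFagree)
  have hnotmem_of_le : ∀ m' : M, ι m' 4 ≤ 1 - δ → m' ∉ e 0 '' closedBall 0 R := by
    rintro m' hle ⟨v, -, rfl⟩
    exact absurd (hold v) (not_lt.2 hle)
  have hσeq : ∀ m' : M, ι m' 4 ≤ 1 - δ → σ =ᶠ[𝓝 m'] proj5 ∘ ι := by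
    intro m' hle
    filter_upwards [patch_eventuallyEq_of_notMem (ι := ι) (F := F) he (hnotmem_of_le m' hle)]
      with m'' hm''
    show proj5 (patch ι (e 0) R F m'') = proj5 (ι m'')
    rw [hm'']
  have hσinj : ∀ m' : M, 1 - δ < ι m' 4 → Injective (mfderiv (𝓡 4) (𝓡 4) σ m') := by
    intro m' hm'
    by_cases hmem : m' ∈ e 0 '' closedBall 0 R
    · obtain ⟨v, hv, rfl⟩ := hmem
      have hle : ‖v‖ ≤ R := mem_closedBall_zero_iff.1 hv
      refine injective_mfderiv_shadow_patch_chart he hFsmooth hFagree (by linarith) ?_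
      rw [hF, proj5_comp_ironF]
      exact hd v hv
    · rw [hσdef, mfderiv_shadow_patch_of_notMem he hmem]
      refine hclause m' hm' ?_
      simp only [Set.mem_iUnion, not_exists]
      intro j hj
      obtain rfl : j = 0 := Subsingleton.elim j 0
      exact hmem (Set.image_mono (pleatSpheres_subset_closedBall hR2.le) hj)
  -- two preimages of the shadow point `Λ u`: the chart point `e 0 u` …
  have hm₁ : 1 - δ < ι (e 0 u) 4 := hold u
  have hσm₁ : σ (e 0 u) = Λ u := by
    show proj5 (patch ι (e 0) R F (e 0 u)) = Λ u
    rw [patch_chart_of_le he.isEmbedding.injective hu'.le, hF, proj5_ironF]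
  -- … and the foreign point `m`
  have hσm : σ m = Λ u := by
    by_cases hmem : m ∈ e 0 '' closedBall 0 R
    · obtain ⟨v, hv, rfl⟩ := hmem
      have hvR : ‖v‖ = R := by
        refine le_antisymm (mem_closedBall_zero_iff.1 hv) (not_lt.1 fun hlt => ?_)
        exact hnot ⟨v, mem_ball_zero_iff.2 hlt, rfl⟩
      show proj5 (patch ι (e 0) R F (e 0 v)) = Λ u
      rw [patch_chart_of_le he.isEmbedding.injective hvR.le, hF, proj5_ironF,
        hagree v (by rw [hvR]; linarith), ← hux]
    · show proj5 (patch ι (e 0) R F m) = Λ u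
      rw [patch_of_notMem hmem, hux]
  -- the sheet count: fibres over the open ball of radius `ρ` are singletons
  have hnorm : ‖Λ u‖ < Real.sqrt (1 - (1 - δ) ^ 2) := by
    rw [← hσm₁]
    exact norm_sigma_lt hι hδ hδ1 hround hσ hσinj hσeq hm₁
  obtain ⟨m₀, -, -, huniq⟩ := existsUnique_preimage_sigma hι hδ hδ1 hround hσ hσinj hσeq hnorm
  have h1 := huniq (e 0 u) hm₁ hσm₁
  have h2 := huniq m hm hσm
  exact hnot ⟨u, hu, h1.trans h2.symm⟩

/-- **STUB S5a of line `shadow-pleats` (CLEAN ONE-PLEAT IRONING; TRUE).**  A homotopy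
`4`-sphere `M` admitting a `1`-pleat round-rim shadow position WHOSE CHART IS CLEAN
(`HasCleanPleatedPosition M 1`) admits a pleat-free one (`HasPleatedPosition M 0`): the
deletion construction of Disproof.lean §7c (γ) in kernel form (file III,
`cleanOnePleatIroning_of_ironingChart`) over the ironing chart of `cleanPleatIroningChart`.
[folklore] -/
theorem stub_cleanOnePleatIroning :
    ∀ (M : Type) [TopologicalSpace M] [T2Space M] [SecondCountableTopology M]
      [ChartedSpace (EuclideanSpace ℝ (Fin 4)) M] [IsManifold (𝓡 4) ∞ M],
      M ≃ₕ (Metric.sphere (0 : EuclideanSpace ℝ (Fin 5)) 1) →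
      HasCleanPleatedPosition M 1 → HasPleatedPosition M 0 :=
  cleanOnePleatIroning_of_ironingChart cleanPleatIroningChart

end Summit.SmoothPoincare4.SmoothPoincare4.Theorems.OrigamiFoldExistence.ShadowPleats

end
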